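import Summits.Ventures.YMGap.RobustBall.RowsSU3StarPVW
import Summits.Ventures.YMGap.Thresholds.OneLinkVarianceBoundSU2
import HarnessLib

/-!
# Venture YMGap, track ROBUST-BALL (Y2) — W19: `SU(2)` STAR SCHEMAS IN THE VARIANCE FORM on the tree's sharp `SU(2)` pair
# `(c_P, v) = (2/3, 2)` (`oneLinkPoincareSUN_two_sharp`, `oneLinkVarianceBound_two_of_le_fifth`, radius `3β_W/2`, `β_W ≤ 1/5`)

HONEST FRAMING. WHAT THIS IS: a venture file (cell `pub-ymgap`, track Y2 ROBUST-BALL, seat ds-2): the robust star doors in variance form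
(`RobustStarDoorVariance`, `RobustStarDoorZdVariance`) for `SU(2)`, `d = 4` / `d = 3`, fed with the in-tree pair `(2/3, 2)`: robust coefficient
`c ≥ e^{ε₀}·√(4/3)·β_W/4` (`√(4/3) ≤ 1.1548`) and off-column rows `λ ≥ e^{ε₀/2}·√(2/3)·ε₁` (`√(2/3) ≤ 0.8165`) — versus the quarter-modulus route of
`TorusRowsSU2Star` / `MassGapOnBallZdGRows` (`c ≥ e^{ε₀}(1 + 2√2 ε₁)β_W/4`, `λ ≥ √2 ε₁`): for `β_W ≤ 1/5` the variance form has the smaller `λ` and no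
`(1 + 2√2 ε₁)` factor, hence LARGER radii (the quarter modulus keeps the larger THRESHOLD, 9/25). Schemas: `su2_torusClusteringOnBallUpTo_star_var`
(tier 1, d = 4), `su2_massGapOnBallZdG_star_var` (`ℤ⁴`), `su2_clusterDomainClustering_dim3_star_var` (d = 3, Y4 + torus), `su2_massGapOnBallZdG_dim3_star_var`
(`ℤ³`), `su2_torusClusteringOnBallW_star_var` (tier 2, d = 4), `su2_clusterDomainClusteringW_dim3_star_var` (tier 2, d = 3). Cells: `RowsSU2StarVar.lean`.
WHAT THIS IS NOT: `β_W ≤ 1/5` only (the variance bound's radius); radii are door artefacts; nothing about the continuum or the Millennium problem.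
-/

noncomputable section

open Finset
open Literature.MathematicalPhysics.QuantumLattice (fundamentalRep)
open Literature.MathematicalPhysics.QuantumFieldTheory hiding ZdEdge
open Literature.MathematicalPhysics.QuantumFieldTheory.Balaban1983to89.StrongCouplingTorusWindow
open Summit.QuantumFields.BalabanUV.InfraRed.StrongCouplingPoincareDoorSUN (OneLinkPoincareSUN oneLinkPoincareSUN_two_sharp)
open Summit.QuantumFields.BalabanUV.InfraRed.StrongCouplingVarianceDoorSUN (OneLinkVarianceBound)
open Summit.Ventures.YMGap.OneLinkVarianceBoundSU2 (oneLinkVarianceBound_two_of_le_fifth)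
open Summit.Ventures.YMGap.StarResolventDim (Delta gaugeR doorPoly Delta_pos_of_door gaugeR_lt_one_of_door)

namespace Summit.Ventures.YMGap.RobustBall

/-! ### The `SU(2)` pair inputs -/

/-- `√(4/3) ≤ 1.1548` and `√(2/3) ≤ 0.8165`. [folklore] -/
theorem sqrt_fourThirds_le_and : Real.sqrt (2 / 3 * 2) ≤ 11548 / 10000 ∧ Real.sqrt (2 / 3) ≤ 8165 / 10000 := by
  constructor
  · rw [show (11548 / 10000 : ℝ) = Real.sqrt ((11548 / 10000) ^ 2) by rw [Real.sqrt_sq (by norm_num)]]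
    exact Real.sqrt_le_sqrt (by norm_num)
  · rw [show (8165 / 10000 : ℝ) = Real.sqrt ((8165 / 10000) ^ 2) by rw [Real.sqrt_sq (by norm_num)]]
    exact Real.sqrt_le_sqrt (by norm_num)

/-- The two door inputs for `SU(2)` on the pair `(2/3, 2)`: `e^{ε₀}√(4/3)·x ≤ E·1.1548·x` and `e^{ε₀/2}√(2/3)·ε₁ ≤ E₂·0.8165·ε₁`. [folklore] -/
theorem su2_var_star_inputs {ε₀ ε₁ E E₂ x : ℝ} (hε₁ : 0 ≤ ε₁) (hx : 0 ≤ x) (hE : Real.exp ε₀ ≤ E) (hE₂ : Real.exp (ε₀ / 2) ≤ E₂) :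
    Real.exp ε₀ * Real.sqrt (2 / 3 * 2) * x ≤ E * (11548 / 10000) * x ∧
      Real.exp (ε₀ / 2) * Real.sqrt (2 / 3) * ε₁ ≤ E₂ * (8165 / 10000) * ε₁ := by
  obtain ⟨h1, h2⟩ := sqrt_fourThirds_le_and
  have hE0 : 0 ≤ E := (Real.exp_pos _).le.trans hE
  have hE20 : 0 ≤ E₂ := (Real.exp_pos _).le.trans hE₂
  exact ⟨mul_le_mul_of_nonneg_right (mul_le_mul hE h1 (Real.sqrt_nonneg _) hE0) hx,
    mul_le_mul_of_nonneg_right (mul_le_mul hE₂ h2 (Real.sqrt_nonneg _) hE20) hε₁⟩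

/-! ### Schemas, `SU(2)`, variance form on the pair `(2/3, 2)` (`0 < β_W ≤ 1/5`) -/

/-- **SCHEMA, `SU(2)`, `d = 4`, tier 1, variance form**: `TorusClusteringOnBallUpTo 2 4 (β_W/2) ε₀ ε₁ r A m` for some `m > 0` from the certificate
`doorPoly 4 c < 1 ∧ 6c + λ < 1 ∧ gaugeR 4 c + (λ + (6c+λ)^K·16λ)/(1−(6c+λ)) < 1` with `c ≥ E·1.1548·β_W/4`, `λ ≥ E₂·0.8165·ε₁`. [folklore] -/
theorem su2_torusClusteringOnBallUpTo_star_var (Kn : ℕ) {βW ε₀ ε₁ c lam E E₂ : ℝ} (hβ0 : 0 < βW) (hβ : βW ≤ 1 / 5) (hε₁ : 0 ≤ ε₁)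
    (hE : Real.exp ε₀ ≤ E) (hE₂ : Real.exp (ε₀ / 2) ≤ E₂) (hc : E * (11548 / 10000) * (βW / 4) ≤ c) (hlam : E₂ * (8165 / 10000) * ε₁ ≤ lam)
    (hθ1 : 6 * c + lam < 1) (hcd : doorPoly 4 c < 1)
    (hρ1 : gaugeR 4 c + (lam + (6 * c + lam) ^ Kn * (16 * lam)) / (1 - (6 * c + lam)) < 1) (r : ℕ) :
    ∃ A m : ℝ, 0 < m ∧ TorusClusteringOnBallUpTo 2 4 (βW / 2) ε₀ ε₁ r A m := by
  have hP : OneLinkPoincareSUN 2 (3 * βW / 2) (2 / 3) := oneLinkPoincareSUN_two_sharp _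
  have hV : OneLinkVarianceBound 2 (3 * βW / 2) 2 := oneLinkVarianceBound_two_of_le_fifth hβ
  obtain ⟨h1, h2⟩ := su2_var_star_inputs (x := βW / 4) hε₁ (by positivity) hE hE₂
  have hc0 : 0 ≤ c := le_trans (le_trans (by positivity) h1) hc
  have hE20 : 0 ≤ E₂ := (Real.exp_pos _).le.trans hE₂
  have hlam0 : 0 ≤ lam := le_trans (by positivity) hlam
  set θ : ℝ := 6 * c + lam with hθ
  set ρ : ℝ := gaugeR 4 c + (lam + θ ^ Kn * (16 * lam)) / (1 - θ) with hρ
  have hθ0 : 0 ≤ θ := by positivity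
  have hgR := gaugeR_lt_one_of_door (d := 4) (by norm_num) hc0 hcd
  have hρ0 : 0 ≤ ρ := by
    have : 0 ≤ θ ^ Kn := pow_nonneg hθ0 Kn
    have h1' : 0 < 1 - θ := by linarith
    rw [hρ]; exact add_nonneg hgR.1 (div_nonneg (by positivity) h1'.le)
  have hb' : βW / 2 / ((2 : ℕ) : ℝ) * (2 * (((4 : ℕ) : ℝ) - 1)) ≤ 3 * βW / 2 := by push_cast; linarith
  have hc' : Real.exp ε₀ * Real.sqrt (2 / 3 * 2) * (βW / 2 / ((2 : ℕ) : ℝ)) ≤ c := by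
    rw [show βW / 2 / ((2 : ℕ) : ℝ) = βW / 4 by push_cast; ring]; exact h1.trans hc
  have hθ' : θ = (2 * ((4 : ℕ) : ℝ) - 2) * c + lam := by rw [hθ]; push_cast; ring
  have hρ' : ρ = gaugeR 4 c + (lam + θ ^ Kn * (4 * ((4 : ℕ) : ℝ) * lam)) / (1 - θ) := by rw [hρ]; push_cast; ring
  have h := torusClusteringOnBallUpTo_of_robustStar_variance (d := 4) (N := 2) (by norm_num) (by norm_num) r Kn (by norm_num) (by norm_num)
    hb' hP hV hε₁ hc' (h2.trans hlam) hθ' hθ1 hcd hρ' hρ1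
  refine ⟨_, _, ?_, h⟩
  have h1' : 0 < 1 - ρ := by linarith
  have hden : 0 < 2 * (2 * ρ * ((2 * 4 : ℕ) : ℝ) + 1) := by push_cast; nlinarith
  positivity

/-- **SCHEMA, `SU(2)`, `ℤ⁴`, variance form**: `MassGapOnBallZdG 4 2 (β_W/4) ε₀ ε₁ R` (gauge-invariant tier-1 ball; exactly one DLR state +
SZZ clustering). [folklore] -/
theorem su2_massGapOnBallZdG_star_var (Kn : ℕ) {βW ε₀ ε₁ c lam E E₂ : ℝ} (hβ0 : 0 < βW) (hβ : βW ≤ 1 / 5) (hε₁ : 0 ≤ ε₁)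
    (hE : Real.exp ε₀ ≤ E) (hE₂ : Real.exp (ε₀ / 2) ≤ E₂) (hc : E * (11548 / 10000) * (βW / 4) ≤ c) (hlam : E₂ * (8165 / 10000) * ε₁ ≤ lam)
    (hθ1 : 6 * c + lam < 1) (hcd : doorPoly 4 c < 1)
    (hρ1 : gaugeR 4 c + (lam + (6 * c + lam) ^ Kn * (16 * lam)) / (1 - (6 * c + lam)) < 1) (R : ℕ) :
    MassGapOnBallZdG 4 2 (βW / 4) ε₀ ε₁ R := by
  have hP : OneLinkPoincareSUN 2 (3 * βW / 2) (2 / 3) := oneLinkPoincareSUN_two_sharp _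
  have hV : OneLinkVarianceBound 2 (3 * βW / 2) 2 := oneLinkVarianceBound_two_of_le_fifth hβ
  obtain ⟨h1, h2⟩ := su2_var_star_inputs (x := βW / 4) hε₁ (by positivity) hE hE₂
  have hc0 : 0 ≤ c := le_trans (le_trans (by positivity) h1) hc
  have hE20 : 0 ≤ E₂ := (Real.exp_pos _).le.trans hE₂
  have hlam0 : 0 ≤ lam := le_trans (by positivity) hlam
  have hq : |((2 : ℕ) : ℝ) * (βW / 4)| / ((2 : ℕ) : ℝ) = βW / 4 := by
    rw [abs_of_pos (by positivity)]; push_cast; ring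
  have hb' : |((2 : ℕ) : ℝ) * (βW / 4)| / ((2 : ℕ) : ℝ) * (2 * (((4 : ℕ) : ℝ) - 1)) ≤ 3 * βW / 2 := by rw [hq]; norm_num; linarith
  have hc' : Real.exp ε₀ * Real.sqrt (2 / 3 * 2) * (|((2 : ℕ) : ℝ) * (βW / 4)| / ((2 : ℕ) : ℝ)) ≤ c := by rw [hq]; exact h1.trans hc
  have hθ' : (6 : ℝ) * c + lam = (2 * ((4 : ℕ) : ℝ) - 2) * c + lam := by push_cast; ring
  have hρ' : gaugeR 4 c + (lam + (6 * c + lam) ^ Kn * (16 * lam)) / (1 - (6 * c + lam)) =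
      gaugeR 4 c + (lam + (6 * c + lam) ^ Kn * (4 * ((4 : ℕ) : ℝ) * lam)) / (1 - (6 * c + lam)) := by push_cast; ring
  exact massGapOnBallZdG_of_robustStar_variance (d := 4) (N := 2) (by norm_num) (by norm_num) (Kn := Kn) (by norm_num) (by norm_num)
    hb' hP hV hε₁ hc' (h2.trans hlam) hθ' hθ1 hcd hρ' hρ1

/-- **SCHEMA, `SU(2)`, `d = 3`, tier 1, variance form**: Y4's `ClusterDomainClustering` on `ClusterDomainFR ε₀ ε₁ r` up to `β_W/2`, plus the torus form
(door `8c² + 6c < 1`, `θ = 4c + λ`). [folklore] -/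
theorem su2_clusterDomainClustering_dim3_star_var (Kn : ℕ) {βW ε₀ ε₁ c lam E E₂ : ℝ} (hβ0 : 0 < βW) (hβ : βW ≤ 1 / 5) (hε₁ : 0 ≤ ε₁)
    (hE : Real.exp ε₀ ≤ E) (hE₂ : Real.exp (ε₀ / 2) ≤ E₂) (hc : E * (11548 / 10000) * (βW / 4) ≤ c) (hlam : E₂ * (8165 / 10000) * ε₁ ≤ lam)
    (hθ1 : 4 * c + lam < 1) (hcd : doorPoly 3 c < 1)
    (hρ1 : gaugeR 3 c + (lam + (4 * c + lam) ^ Kn * (12 * lam)) / (1 - (4 * c + lam)) < 1) (r : ℕ) :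
    ∃ m : ℝ, 0 < m ∧
      YM3IR.ClusterDomainClustering (G := SUN 2)
        ⟨fundamentalRep (Fin 2), βW / 2, fun _ _ W => W ∈ ClusterDomainFR ε₀ ε₁ r⟩ suFrobDist m ∧
      ∃ A : ℝ, TorusClusteringOnBallUpTo 2 3 (βW / 2) ε₀ ε₁ r A m := by
  have hP : OneLinkPoincareSUN 2 (3 * βW / 2) (2 / 3) := oneLinkPoincareSUN_two_sharp _
  have hV : OneLinkVarianceBound 2 (3 * βW / 2) 2 := oneLinkVarianceBound_two_of_le_fifth hβ
  obtain ⟨h1, h2⟩ := su2_var_star_inputs (x := βW / 4) hε₁ (by positivity) hE hE₂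
  have hc0 : 0 ≤ c := le_trans (le_trans (by positivity) h1) hc
  have hE20 : 0 ≤ E₂ := (Real.exp_pos _).le.trans hE₂
  have hlam0 : 0 ≤ lam := le_trans (by positivity) hlam
  set θ : ℝ := 4 * c + lam with hθ
  set ρ : ℝ := gaugeR 3 c + (lam + θ ^ Kn * (12 * lam)) / (1 - θ) with hρ
  have hθ0 : 0 ≤ θ := by positivity
  have hgR := gaugeR_lt_one_of_door (d := 3) (by norm_num) hc0 hcd
  have hρ0 : 0 ≤ ρ := by
    have : 0 ≤ θ ^ Kn := pow_nonneg hθ0 Kn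
    have h1' : 0 < 1 - θ := by linarith
    rw [hρ]; exact add_nonneg hgR.1 (div_nonneg (by positivity) h1'.le)
  have hb4 : βW / 2 / ((2 : ℕ) : ℝ) * 4 ≤ 3 * βW / 2 := by push_cast; linarith
  have hb' : βW / 2 / ((2 : ℕ) : ℝ) * (2 * (((3 : ℕ) : ℝ) - 1)) ≤ 3 * βW / 2 := by push_cast; linarith
  have hc' : Real.exp ε₀ * Real.sqrt (2 / 3 * 2) * (βW / 2 / ((2 : ℕ) : ℝ)) ≤ c := by
    rw [show βW / 2 / ((2 : ℕ) : ℝ) = βW / 4 by push_cast; ring]; exact h1.trans hc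
  have hθ' : θ = (2 * ((3 : ℕ) : ℝ) - 2) * c + lam := by rw [hθ]; push_cast; ring
  have hρ' : ρ = gaugeR 3 c + (lam + θ ^ Kn * (4 * ((3 : ℕ) : ℝ) * lam)) / (1 - θ) := by rw [hρ]; push_cast; ring
  have hm : 0 < (1 - ρ) ^ 2 / (2 * (2 * ρ * ((2 * 3 : ℕ) : ℝ) + 1)) / ((max r 1 + 2 : ℕ) : ℝ) := by
    have h1' : 0 < 1 - ρ := by linarith
    have hden : 0 < 2 * (2 * ρ * ((2 * 3 : ℕ) : ℝ) + 1) := by push_cast; nlinarith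
    positivity
  refine ⟨_, hm, clusterDomainClustering_dim3_of_robustStar_variance (N := 2) (by norm_num) r Kn (by norm_num) (by norm_num) hb4 hP hV hε₁
    hc' (h2.trans hlam) hθ hθ1 hcd hρ hρ1, _,
    torusClusteringOnBallUpTo_of_robustStar_variance (d := 3) (N := 2) (by norm_num) (by norm_num) r Kn (by norm_num) (by norm_num) hb'
      hP hV hε₁ hc' (h2.trans hlam) hθ' hθ1 hcd hρ' hρ1⟩

/-- **SCHEMA, `SU(2)`, `ℤ³`, variance form**: `MassGapOnBallZdG 3 2 (β_W/4) ε₀ ε₁ R`. [folklore] -/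
theorem su2_massGapOnBallZdG_dim3_star_var (Kn : ℕ) {βW ε₀ ε₁ c lam E E₂ : ℝ} (hβ0 : 0 < βW) (hβ : βW ≤ 1 / 5) (hε₁ : 0 ≤ ε₁)
    (hE : Real.exp ε₀ ≤ E) (hE₂ : Real.exp (ε₀ / 2) ≤ E₂) (hc : E * (11548 / 10000) * (βW / 4) ≤ c) (hlam : E₂ * (8165 / 10000) * ε₁ ≤ lam)
    (hθ1 : 4 * c + lam < 1) (hcd : doorPoly 3 c < 1)
    (hρ1 : gaugeR 3 c + (lam + (4 * c + lam) ^ Kn * (12 * lam)) / (1 - (4 * c + lam)) < 1) (R : ℕ) :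
    MassGapOnBallZdG 3 2 (βW / 4) ε₀ ε₁ R := by
  have hP : OneLinkPoincareSUN 2 (3 * βW / 2) (2 / 3) := oneLinkPoincareSUN_two_sharp _
  have hV : OneLinkVarianceBound 2 (3 * βW / 2) 2 := oneLinkVarianceBound_two_of_le_fifth hβ
  obtain ⟨h1, h2⟩ := su2_var_star_inputs (x := βW / 4) hε₁ (by positivity) hE hE₂
  have hc0 : 0 ≤ c := le_trans (le_trans (by positivity) h1) hc
  have hE20 : 0 ≤ E₂ := (Real.exp_pos _).le.trans hE₂
  have hlam0 : 0 ≤ lam := le_trans (by positivity) hlam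
  have hq : |((2 : ℕ) : ℝ) * (βW / 4)| / ((2 : ℕ) : ℝ) = βW / 4 := by
    rw [abs_of_pos (by positivity)]; push_cast; ring
  have hb' : |((2 : ℕ) : ℝ) * (βW / 4)| / ((2 : ℕ) : ℝ) * (2 * (((3 : ℕ) : ℝ) - 1)) ≤ 3 * βW / 2 := by rw [hq]; norm_num; linarith
  have hc' : Real.exp ε₀ * Real.sqrt (2 / 3 * 2) * (|((2 : ℕ) : ℝ) * (βW / 4)| / ((2 : ℕ) : ℝ)) ≤ c := by rw [hq]; exact h1.trans hc
  have hθ' : (4 : ℝ) * c + lam = (2 * ((3 : ℕ) : ℝ) - 2) * c + lam := by push_cast; ring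
  have hρ' : gaugeR 3 c + (lam + (4 * c + lam) ^ Kn * (12 * lam)) / (1 - (4 * c + lam)) =
      gaugeR 3 c + (lam + (4 * c + lam) ^ Kn * (4 * ((3 : ℕ) : ℝ) * lam)) / (1 - (4 * c + lam)) := by push_cast; ring
  exact massGapOnBallZdG_of_robustStar_variance (d := 3) (N := 2) (by norm_num) (by norm_num) (Kn := Kn) (by norm_num) (by norm_num)
    hb' hP hV hε₁ hc' (h2.trans hlam) hθ' hθ1 hcd hρ' hρ1

/-- **SCHEMA, `SU(2)`, `d = 4`, TIER 2, variance form**: `TorusClusteringOnBallW 2 4 β κ ε₀ ε₁ (16e^{2t}) t` for every `0 ≤ β ≤ β_W/2`. [folklore] -/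
theorem su2_torusClusteringOnBallW_star_var (Kn : ℕ) {βW κ ε₀ ε₁ c lam E E₂ t T₁ T₂ : ℝ} (hβ0 : 0 < βW) (hβ : βW ≤ 1 / 5) (hε₁ : 0 ≤ ε₁)
    (ht : 0 ≤ t) (htκ : t ≤ κ) (hE : Real.exp ε₀ ≤ E) (hE₂ : Real.exp (ε₀ / 2) ≤ E₂) (hT₁ : Real.exp t ≤ T₁) (hT₂ : Real.exp (2 * t) ≤ T₂)
    (hc : E * (11548 / 10000) * (βW / 4) ≤ c) (hlam : E₂ * (8165 / 10000) * ε₁ ≤ lam) (hθ1 : 6 * c + lam < 1) (hcd : doorPoly 4 c < 1)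
    (hρ1 : T₁ * (gaugeR 4 c + (T₂ * lam + (6 * c + lam) ^ Kn * (16 * (T₂ * lam))) / (1 - (6 * c + lam))) < 1) :
    ∀ β : ℝ, 0 ≤ β → β ≤ βW / 2 → TorusClusteringOnBallW 2 4 β κ ε₀ ε₁ (16 * Real.exp (2 * t)) t := by
  have hP : OneLinkPoincareSUN 2 (3 * βW / 2) (2 / 3) := oneLinkPoincareSUN_two_sharp _
  have hV : OneLinkVarianceBound 2 (3 * βW / 2) 2 := oneLinkVarianceBound_two_of_le_fifth hβ
  obtain ⟨h1, h2⟩ := su2_var_star_inputs (x := βW / 4) hε₁ (by positivity) hE hE₂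
  have hc0 : 0 ≤ c := le_trans (le_trans (by positivity) h1) hc
  have hE20 : 0 ≤ E₂ := (Real.exp_pos _).le.trans hE₂
  have hlam0 : 0 ≤ lam := le_trans (by positivity) hlam
  set θ : ℝ := 6 * c + lam with hθ
  set ρ : ℝ := Real.exp t * (gaugeR 4 c +
    (Real.exp (2 * t) * lam + θ ^ Kn * (16 * (Real.exp (2 * t) * lam))) / (1 - θ)) with hρ
  have hθ0 : 0 ≤ θ := by positivity
  have h1θ : 0 < 1 - θ := by linarith
  have hgR := gaugeR_lt_one_of_door (d := 4) (by norm_num) hc0 hcd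
  have hθK : 0 ≤ θ ^ Kn := pow_nonneg hθ0 Kn
  have hin0 : 0 ≤ gaugeR 4 c + (Real.exp (2 * t) * lam + θ ^ Kn * (16 * (Real.exp (2 * t) * lam))) / (1 - θ) :=
    add_nonneg hgR.1 (div_nonneg (by positivity) h1θ.le)
  have hin : gaugeR 4 c + (Real.exp (2 * t) * lam + θ ^ Kn * (16 * (Real.exp (2 * t) * lam))) / (1 - θ) ≤
      gaugeR 4 c + (T₂ * lam + θ ^ Kn * (16 * (T₂ * lam))) / (1 - θ) := by
    have h1' : Real.exp (2 * t) * lam ≤ T₂ * lam := mul_le_mul_of_nonneg_right hT₂ hlam0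
    have h2' : θ ^ Kn * (16 * (Real.exp (2 * t) * lam)) ≤ θ ^ Kn * (16 * (T₂ * lam)) :=
      mul_le_mul_of_nonneg_left (by linarith) hθK
    exact add_le_add le_rfl (div_le_div_of_nonneg_right (add_le_add h1' h2') h1θ.le)
  have hρ1' : ρ < 1 :=
    calc ρ ≤ T₁ * (gaugeR 4 c + (T₂ * lam + θ ^ Kn * (16 * (T₂ * lam))) / (1 - θ)) :=
          mul_le_mul hT₁ hin hin0 ((Real.exp_pos _).le.trans hT₁)
      _ < 1 := hρ1
  have hb' : βW / 2 / ((2 : ℕ) : ℝ) * (2 * (((4 : ℕ) : ℝ) - 1)) ≤ 3 * βW / 2 := by push_cast; linarith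
  have hc' : Real.exp ε₀ * Real.sqrt (2 / 3 * 2) * (βW / 2 / ((2 : ℕ) : ℝ)) ≤ c := by
    rw [show βW / 2 / ((2 : ℕ) : ℝ) = βW / 4 by push_cast; ring]; exact h1.trans hc
  have hθ' : θ = (2 * ((4 : ℕ) : ℝ) - 2) * c + lam := by rw [hθ]; push_cast; ring
  have hρ' : ρ = Real.exp t * (gaugeR 4 c +
      (Real.exp (2 * t) * lam + θ ^ Kn * (4 * ((4 : ℕ) : ℝ) * (Real.exp (2 * t) * lam))) / (1 - θ)) := by
    rw [hρ]; push_cast; ring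
  have h := torusClusteringOnBallW_upTo_of_robustStar_variance (d := 4) (N := 2) (by norm_num) (by norm_num) Kn (by norm_num) (by norm_num)
    hb' hP hV hε₁ ht htκ hc' (h2.trans hlam) hθ' hθ1 hcd hρ' hρ1'
  rw [two_mul_sq_two_sqrt_two] at h
  exact h

end Summit.Ventures.YMGap.RobustBall

end
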